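import Literature.NumberTheory.LFunctions.ExplicitZeroFreeRegionKernel
import Literature.NumberTheory.LFunctions.ZetaLittlewoodRegionExplicit
import Literature.NumberTheory.LFunctions.ZetaFirstZeroCertificate
import HarnessLib

/-!
# RH-FREE — the Bellotti–Trudgian–Yang classical zero-free region `σ > 1 − 1/(4.896 log t)` («nothing here bears on the truth of RH»)

Topic `Literature/NumberTheory/LFunctions` (RH literature-typing tranche 1, L4 "explicit zero
statistics": explicit zero-free regions). Label: **RH-FREE** — an unconditional CLAIMED theorem of
an unrefereed 2026 preprint, vendored as NAMED FACTS (`def … : Prop`, D-0014; tagged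
`[claim: …, status: under-review]` per D-0012; nothing asserted, users take `(h : …)`), plus the
cheap kernel consequences that plug it into the tree's zero-free-region vocabulary. Nothing here
bears on the truth of RH.

Source: C. Bellotti, T. Trudgian, A. Yang, *Zero-free regions inspired by work of Heath-Brown*,
arXiv:2603.21490v1 (23 Mar 2026), typed from the arXiv TeX source (`Bellotti_Trudgian_Yang_v1.tex`:
Theorem 1 = `\label{intro_new_theorem1}` l.74–76, Lemma 1 = `\label{classical_main_lem}` l.79–84,
the deduction "Theorem 1 ⟸ Lemma 1 + Yang's Littlewood region" l.85–93, §5 `\label{castle}` with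
the iteration Lemma `\label{classical_iteration_lem}` l.1076–1158):

* `zero_free_region_bellotti_trudgian_yang` — **Theorem 1**: "If `t ≥ 3` then `ζ(σ + it) ≠ 0` in
  the region `σ > 1 − 1/(4.896 log t)`" — improving the constant `5.558691` of
  Mossinghoff–Trudgian–Yang 2024 (tree: `zero_free_region_mossinghoff_trudgian_yang`, PROVED in the
  tree modulo `platt_trudgian_numerical_rh` in `ExplicitZeroFreeRegionRoundsProofs.lean`) by
  combining Stechkin's and Heath-Brown's smoothings of the zero-detector `Σ Λ(n) n^{-s}` with a
  degree-16 non-negative trigonometric polynomial;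
* `BellottiTrudgianYang2026_lemma1` — **Lemma 1**: the same for `3 ≤ t ≤ exp(76.47)` (the range
  actually established by the smoothing argument of §§2–5; above `exp(76.463)` Yang's explicit
  Littlewood region `σ > 1 − log log t/(21.233 log t)` — tree: `zero_free_region_littlewood_yang` —
  is wider).

Proved here (no new hypotheses beyond the two facts):
* `zero_free_region_bellotti_trudgian_yang_of_lemma1` — the source's deduction of Theorem 1 from
  Lemma 1 and `zero_free_region_littlewood_yang` (numerics: `4.896 · log 76.47 ≥ 21.233`, via
  `exp 4.33685 ≤ 76.47`);
* `zero_free_region_bellotti_trudgian_yang.abs` (both signs of `t`, conjugation),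
  `.re_le_of_zero`, `.hasOpenClassicalZeroFreeRegion` (**`HasOpenClassicalZeroFreeRegion 4.896`**:
  the tree's `|t| ≥ 2` spelling — heights `2 ≤ |t| < 3` carry no zeros at all,
  `riemannZeta_ne_zero_of_im_pos_of_im_le_fourteen`), `.hasClassicalZeroFreeRegion` (the CLOSED
  region `σ ≥ 1 − 1/(R log|t|)`, `|t| ≥ 2`, for every `R > 4.896` — exactly the hypothesis shape
  `hZFR` of `FKS2023.zfrHeight_lt_im`, `JohnstonYang2023_eq37_of`, `FioriKadiriSwidinsky2023_eq41'`),
  and `.mossinghoff_trudgian_yang` (Theorem 1 implies the MTY fact).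

Deliberately NOT typed: **Theorem 2 / Lemma 2** of the source (constant `4.8594`, range
`exp(56.693)`), which the source states only conditionally ("would yield … would follow") on the
improved Littlewood/Vinogradov–Korobov constants `19.62`/`51.34` of A. Yang's 2025 UNSW thesis — not
a published theorem; the smoothing function `f`, the trigonometric polynomial and the numerics of
§§2–5 (the proof). Reading note: the parameter table of §3 prints `A₀ = (4.8596)⁻¹` for Lemma 1,
but its `η₀ = A₀/log H = 0.0071093…` (`H = 3·10¹²`) is `(4.896)⁻¹/log H`; we type the constant
`4.896` of the stated Lemma 1/Theorem 1.

## References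

* C. Bellotti, T. Trudgian, A. Yang, arXiv:2603.21490v1 (2026), Thm. 1, Lemma 1.
  [BellottiTrudgianYang2026] (preprint, under review)
* A. Yang, J. Math. Anal. Appl. 534 (2024) 128124, Cor. 1.2 (explicit Littlewood region). [Yang2024]
* M. J. Mossinghoff, T. S. Trudgian, A. Yang, Res. Number Theory 10 (2024), Thm. 1.3 (`5.558691`).
  [MossinghoffTrudgianYangRNT2024]
-/

noncomputable section

open Complex Real

namespace Literature.NumberTheory.LFunctions

/-! ## The named facts -/

/-- NAMED FACT (Bellotti–Trudgian–Yang 2026, **Theorem 1**, as printed: "If `t ≥ 3` then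
`ζ(σ + it) ≠ 0` in the region `σ > 1 − 1/(4.896 log t)`"). The classical (de la Vallée Poussin)
zero-free region with constant `R = 4.896`, improving `5.558691` (Mossinghoff–Trudgian–Yang 2024).
PREPRINT (arXiv v1, March 2026), unrefereed. Unconditional as claimed. Users take
`(h : zero_free_region_bellotti_trudgian_yang)`; the tree's `|t| ≥ 2` spellings are
`zero_free_region_bellotti_trudgian_yang.hasOpenClassicalZeroFreeRegion` /
`.hasClassicalZeroFreeRegion` below. [claim: BellottiTrudgianYang2026, status: under-review] -/
def zero_free_region_bellotti_trudgian_yang : Prop :=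
  ∀ σ t : ℝ, 3 ≤ t → 1 - 1 / (4.896 * Real.log t) < σ → riemannZeta (σ + t * I) ≠ 0

/-- NAMED FACT (Bellotti–Trudgian–Yang 2026, **Lemma 1**, as printed: "If `3 ≤ t ≤ exp(76.47)` then
`ζ(σ + it) ≠ 0` in the region `σ > 1 − 1/(4.896 log t)`"). This is the range in which the source's
smoothed zero-detector argument (§§2–5, iteration Lemma with `ε = 10⁻¹⁰⁰` from any classical region
with constant `> 1/6`, and RH verified to `3·10¹²` below `H`) is carried out; Theorem 1 follows from
it and Yang's explicit Littlewood region (`zero_free_region_bellotti_trudgian_yang_of_lemma1`).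
PREPRINT, unrefereed. Users take `(h : BellottiTrudgianYang2026_lemma1)`.
[claim: BellottiTrudgianYang2026, status: under-review] -/
def BellottiTrudgianYang2026_lemma1 : Prop :=
  ∀ σ t : ℝ, 3 ≤ t → t ≤ Real.exp 76.47 → 1 - 1 / (4.896 * Real.log t) < σ →
    riemannZeta (σ + t * I) ≠ 0

/-! ## Numerics for the deduction Theorem 1 ⟸ Lemma 1 + Littlewood region -/

/-- `exp 4.33685 ≤ 76.47` (`exp 1 < 2.7182818286`, `exp 0.33685 ≤ 1.40053` by the Taylor bound).
[folklore] -/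
private theorem exp_433685_le : Real.exp 4.33685 ≤ 76.47 := by
  have h1 : Real.exp 4.33685 = Real.exp 1 ^ 4 * Real.exp 0.33685 := by
    rw [← Real.exp_nat_mul, ← Real.exp_add]; norm_num
  have h2 : Real.exp 0.33685 ≤ 1.40053 := by
    refine (Real.exp_bound' (by norm_num) (by norm_num) (n := 6) (by norm_num)).trans ?_
    norm_num [Finset.sum_range_succ, Nat.factorial]
  have h3 := Real.exp_one_lt_d9
  have h4 : Real.exp 1 ^ 4 ≤ (2.7182818286 : ℝ) ^ 4 := by
    gcongr
  rw [h1]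
  calc Real.exp 1 ^ 4 * Real.exp 0.33685 ≤ (2.7182818286 : ℝ) ^ 4 * 1.40053 := by
        gcongr
    _ ≤ 76.47 := by norm_num

/-- For `log t > 76.47` the Littlewood region of Yang is wider than the classical region with
constant `4.896`: `1/(4.896 log t) ≤ log log t/(21.233 log t)` (i.e. `21.233 ≤ 4.896 log log t`,
true as `log log t > log 76.47 ≥ 4.33685` and `4.896 · 4.33685 > 21.233`).
[claim: BellottiTrudgianYang2026, status: under-review] -/
theorem BellottiTrudgianYang2026.littlewood_le_classical {t : ℝ} (ht : Real.exp 76.47 < t) :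
    1 / (4.896 * Real.log t) ≤ Real.log (Real.log t) / (21.233 * Real.log t) := by
  have ht0 : 0 < t := lt_trans (Real.exp_pos _) ht
  have hlog : 76.47 < Real.log t := by
    rwa [Real.lt_log_iff_exp_lt ht0]
  have hlogpos : 0 < Real.log t := by linarith
  have hll : 4.33685 ≤ Real.log (Real.log t) := by
    rw [Real.le_log_iff_exp_le hlogpos]
    exact exp_433685_le.trans hlog.le
  rw [div_le_div_iff₀ (by positivity) (by positivity)]
  nlinarith

/-- **Theorem 1 from Lemma 1** (the source's deduction, §1): Lemma 1 covers `3 ≤ t ≤ exp(76.47)`;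
for `t > exp(76.47)` a point `σ > 1 − 1/(4.896 log t)` lies in Yang's Littlewood region
`σ > 1 − log log t/(21.233 log t)` (`BellottiTrudgianYang2026.littlewood_le_classical`), where
`zero_free_region_littlewood_yang` applies. [claim: BellottiTrudgianYang2026, status: under-review] -/
theorem zero_free_region_bellotti_trudgian_yang_of_lemma1 (h1 : BellottiTrudgianYang2026_lemma1)
    (hY : zero_free_region_littlewood_yang) : zero_free_region_bellotti_trudgian_yang := by
  intro σ t ht hσ
  rcases le_or_gt t (Real.exp 76.47) with hle | hgt
  · exact h1 σ t ht hle hσ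
  · have hta : |t| = t := abs_of_nonneg (by linarith)
    refine hY σ t (by rw [hta]; exact ht) ?_
    rw [hta]
    have := BellottiTrudgianYang2026.littlewood_le_classical hgt
    linarith

/-! ## Consequences in the tree's vocabulary -/

namespace zero_free_region_bellotti_trudgian_yang

/-- Both signs of the height (conjugation, `riemannZeta_eq_zero_neg_im`): for `|t| ≥ 3` and
`σ > 1 − 1/(4.896 log|t|)`, `ζ(σ + it) ≠ 0`. [claim: BellottiTrudgianYang2026, status: under-review] -/
theorem abs (h : zero_free_region_bellotti_trudgian_yang) :
    ∀ σ t : ℝ, 3 ≤ |t| → 1 - 1 / (4.896 * Real.log |t|) < σ → riemannZeta (σ + t * I) ≠ 0 := by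
  intro σ t ht hσ hzero
  rcases le_or_gt 0 t with ht0 | ht0
  · rw [abs_of_nonneg ht0] at ht hσ
    exact h σ t ht hσ hzero
  · rw [abs_of_neg ht0] at ht hσ
    exact h σ (-t) ht hσ (riemannZeta_eq_zero_neg_im hzero)

/-- Positive-height, non-strict-conclusion reading: a zero `β + it` with `t ≥ 3` satisfies
`β ≤ 1 − 1/(4.896 log t)`. [claim: BellottiTrudgianYang2026, status: under-review] -/
theorem re_le_of_zero (h : zero_free_region_bellotti_trudgian_yang) {β t : ℝ} (ht : 3 ≤ t)
    (hz : riemannZeta (β + t * I) = 0) : β ≤ 1 - 1 / (4.896 * Real.log t) := by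
  by_contra hlt
  push Not at hlt
  exact h β t ht hlt hz

/-- **The tree's open classical region with `R = 4.896`**: `ζ(σ + it) ≠ 0` for `|t| ≥ 2` and
`σ > 1 − 1/(4.896 log|t|)` (`HasOpenClassicalZeroFreeRegion 4.896`). For `|t| ≥ 3` this is
Theorem 1 (both signs); for `2 ≤ |t| < 3` there are no zeros of `ζ` with `0 < |Im s| ≤ 14` at all
(`riemannZeta_ne_zero_of_im_pos_of_im_le_fourteen`, the tree's certified first-zero computation).
[claim: BellottiTrudgianYang2026, status: under-review] -/
theorem hasOpenClassicalZeroFreeRegion (h : zero_free_region_bellotti_trudgian_yang) :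
    HasOpenClassicalZeroFreeRegion 4.896 := by
  intro σ t ht hσ
  rcases le_or_gt 3 |t| with h3 | h3
  · exact h.abs σ t h3 hσ
  · -- `2 ≤ |t| < 3`: no zeros at these heights
    intro hzero
    rcases le_or_gt 0 t with ht0 | ht0
    · rw [abs_of_nonneg ht0] at ht h3
      exact riemannZeta_ne_zero_of_im_pos_of_im_le_fourteen (s := σ + t * I) (by simp; linarith)
        (by simp; linarith) hzero
    · rw [abs_of_neg ht0] at ht h3
      exact riemannZeta_ne_zero_of_im_pos_of_im_le_fourteen (s := σ + (-t : ℝ) * I)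
        (by simp; linarith) (by simp; linarith) (riemannZeta_eq_zero_neg_im hzero)

/-- **The closed classical region for every `R > 4.896`**: `ζ(σ + it) ≠ 0` for `|t| ≥ 2` and
`σ ≥ 1 − 1/(R log|t|)` — literally the hypothesis `hZFR` of `FKS2023.zfrHeight_lt_im`,
`JohnstonYang2023_eq37_of` and `FioriKadiriSwidinsky2023_eq41'`, now available (modulo this claimed
fact) with any `R > 4.896` in place of `5.558691`/`5.5666305`.
[claim: BellottiTrudgianYang2026, status: under-review] -/
theorem hasClassicalZeroFreeRegion (h : zero_free_region_bellotti_trudgian_yang) {R : ℝ}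
    (hR : 4.896 < R) : HasClassicalZeroFreeRegion R :=
  h.hasOpenClassicalZeroFreeRegion.hasClassical (by norm_num) hR

/-- The same, unfolded. [claim: BellottiTrudgianYang2026, status: under-review] -/
theorem zeroFree (h : zero_free_region_bellotti_trudgian_yang) {R : ℝ} (hR : 4.896 < R) :
    ∀ σ t : ℝ, 2 ≤ |t| → 1 - 1 / (R * Real.log |t|) ≤ σ → riemannZeta (σ + t * I) ≠ 0 :=
  h.hasClassicalZeroFreeRegion hR

/-- Theorem 1 implies the Mossinghoff–Trudgian–Yang 2024 region (`R = 5.558691`, the tree's named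
fact `zero_free_region_mossinghoff_trudgian_yang`, rh.S09 explicit form).
[claim: BellottiTrudgianYang2026, status: under-review] -/
theorem mossinghoff_trudgian_yang (h : zero_free_region_bellotti_trudgian_yang) :
    zero_free_region_mossinghoff_trudgian_yang :=
  hasClassicalZeroFreeRegion_iff_mossinghoff_trudgian_yang.1 (h.hasClassicalZeroFreeRegion (by norm_num))

/-- A zero `β + iγ` with `|γ| ≥ 2` satisfies `β ≤ 1 − 1/(4.896 log|γ|)`.
[claim: BellottiTrudgianYang2026, status: under-review] -/
theorem re_le_of_zero_abs (h : zero_free_region_bellotti_trudgian_yang) {β γ : ℝ} (hγ : 2 ≤ |γ|)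
    (hz : riemannZeta (β + γ * I) = 0) : β ≤ 1 - 1 / (4.896 * Real.log |γ|) :=
  h.hasOpenClassicalZeroFreeRegion.re_le hγ hz

end zero_free_region_bellotti_trudgian_yang

end Literature.NumberTheory.LFunctions

end
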